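import Literature.AnabelianGeometry.EtaleTheta.RootsOfUnityGaloisNontrivial
import Literature.AnabelianGeometry.EtaleTheta.RootsOfUnityGaloisNontrivialOddPrime
import Literature.AnabelianGeometry.EtaleTheta.SettingModelCyclotomeModPred
import Literature.AnabelianGeometry.EtaleTheta.SettingModelCyclotomeModTwo
import Literature.IUT.LogVolume.TorsionUnits
import Literature.IUT.LogVolume.PadicSubfields
import HarnessLib

/-!
# Which roots of unity lie in `ℚ_p`: a primitive `N`-th root of unity exists in `ℚ_p` iff `N ∣ p − 1`
# (odd `p`), iff `N ∣ 2` (`p = 2`); equivalently `G_{ℚ_p}` fixes `μ_N(ℚ̄_p)` pointwise iff `N ∣ p − 1` (classical)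

J.-P. Serre, *A Course in Arithmetic*, Ch. II §3.1 Prop. 7 and Cor. (PDF pp. 25–26): "the group of roots of unity
of `ℚ_p` is cyclic of order `p − 1` for `p ≠ 2`, `{±1}` for `p = 2`" [cite: Serre1973, Ch. II §3.1 Prop. 7];
J.-P. Serre, *Local Fields*, IV §4 Prop. 17 (`ℚ_p(ζ_{pⁿ})/ℚ_p` totally ramified of degree `φ(pⁿ)`)
[cite: SerreLocalFields1979, IV §4 Prop 17]; S. Mochizuki, [EtTh] Def. 2.10 p. 44 (`μ_N` with its `G_K`-action)
[cite: MochizukiEtTh2009, Def 2.10 p.44].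

abc-iut cell, layer L2, seat abc-iut-w5-d091 (gen 5), χ-lineage (R78 F3). PROOF-ONLY (no definition, no instance,
no named fact). Completes the classical input of the root-model census of the Tate-twist data
(`SettingModelCyclotomeModEmpty` / `…Two` / `…Pred`, abc-iut-w5-d125, whose FINAL token left «undecided: `N` prime
to `p` with `N ∤ p − 1`»). Everything is assembled from landed decls BY NAME: abc-iut-S1's
`pow_residueCard_sub_one_eq_one_of_not_dvd_orderOf` (a root of unity of a `p`-adic field of order prime to `p` is
killed by `q − 1`) at `K = ℚ_p` with `residueDegree_padic` (`q = p`); abc-iut-w5-d125's `ζ_p ∉ ℚ_p` (odd `p`),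
`ζ_{p²} ∉ ℚ_p` (all `p`), `exists_isPrimitiveRoot_padic_of_dvd_pred` (Hensel), `galMuN_apply_eq_self_of_dvd_pred`,
`galMuN_two_apply`.

* `dvd_pred_of_isPrimitiveRoot_padic_of_not_dvd` — `ζ ∈ ℚ_p` primitive of order `N`, `p ∤ N ⇒ N ∣ p − 1`;
* `not_dvd_of_isPrimitiveRoot_padic` (odd `p`: `p ∤ N`), `not_sq_dvd_of_isPrimitiveRoot_padic` (all `p`: `p² ∤ N`);
* **`dvd_pred_or_of_isPrimitiveRoot_padic`** — `ζ ∈ ℚ_p` primitive of order `N ≠ 0 ⇒ N ∣ p − 1 ∨ (p = 2 ∧ N = 2)`,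
  with converse `exists_isPrimitiveRoot_padic_of_dvd_pred_or`; packaged
  **`exists_isPrimitiveRoot_padic_iff : (∃ ζ : ℚ_[p], IsPrimitiveRoot ζ N) ↔ N ∣ p − 1 ∨ (p = 2 ∧ N = 2)`**,
  `exists_isPrimitiveRoot_padic_iff_dvd_pred` (odd `p`: `↔ N ∣ p − 1`), `exists_isPrimitiveRoot_padic_iff_dvd_two`
  (`p = 2`: `↔ N ∣ 2`);
* Galois forms in `ℚ̄_p = PadicAlgCl p`: `not_mem_range_algebraMap_of_isPrimitiveRoot` / `exists_algEquiv_apply_ne_of_isPrimitiveRoot`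
  (a primitive `N`-th root of unity with `¬(N ∣ p − 1 ∨ (p = 2 ∧ N = 2))` is moved by some `σ ∈ G_{ℚ_p}`),
  `exists_galMuN_apply_ne`'s complement **`galMuN_eq_one_iff : galMuN p N = 1 ↔ N ∣ p − 1 ∨ (p = 2 ∧ N = 2)`** — the
  mod-`N` cyclotomic character of `G_{ℚ_p}` is TRIVIAL exactly at these levels (`galMuN_eq_one_iff_dvd_pred` for odd `p`,
  `galMuN_eq_one_iff_dvd_two` for `p = 2`).
Classical; nothing of [EtTh] is asserted; no side is taken on [IUTchIII] Cor. 3.12.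
-/

noncomputable section

namespace Literature.AnabelianGeometry.EtaleTheta

open Literature.AnabelianGeometry.SemiGraphs

variable (p : ℕ) [hp : Fact p.Prime]

/-! ### Orders prime to `p`: `N ∣ p − 1` -/

/-- **A primitive `N`-th root of unity `ζ ∈ ℚ_p` with `p ∤ N` has `N ∣ p − 1`**: `ζ` is a torsion unit of order
`N` prime to `p`, hence killed by `q − 1 = p − 1` (abc-iut-S1's `pow_residueCard_sub_one_eq_one_of_not_dvd_orderOf`,
reduction to the residue field `𝔽_p`). [cite: Serre1973, Ch. II §3.1 Prop. 7] -/
theorem dvd_pred_of_isPrimitiveRoot_padic_of_not_dvd {N : ℕ} (hN0 : N ≠ 0) (hpN : ¬ p ∣ N) {ζ : ℚ_[p]}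
    (hζ : IsPrimitiveRoot ζ N) : N ∣ p - 1 := by
  have hu : IsUnit ζ := hζ.isUnit hN0
  have hu' : IsPrimitiveRoot hu.unit N :=
    IsPrimitiveRoot.coe_units_iff.mp (by rw [IsUnit.unit_spec]; exact hζ)
  have hmem : hu.unit ∈ Literature.IUT.LogVolume.torsionUnits ℚ_[p] := by
    rw [Literature.IUT.LogVolume.mem_torsionUnits_iff, IsUnit.unit_spec]
    exact ⟨N, Nat.pos_of_ne_zero hN0, hζ.pow_eq_one⟩
  have hord : ¬ p ∣ orderOf hu.unit := by rwa [← hu'.eq_orderOf]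
  have h := Literature.IUT.LogVolume.pow_residueCard_sub_one_eq_one_of_not_dvd_orderOf p ℚ_[p] hmem hord
  rw [Literature.IUT.LogVolume.residueDegree_padic, pow_one] at h
  exact hu'.dvd_of_pow_eq_one _ h

/-- **No primitive root of unity of order divisible by `p²` in `ℚ_p`** (else a primitive `p²`-th root of unity
would lie in `ℚ_p`; abc-iut-w5-d125's `not_mem_range_algebraMap_of_isPrimitiveRoot_sq`).
[cite: SerreLocalFields1979, IV §4 Prop 17] -/
theorem not_sq_dvd_of_isPrimitiveRoot_padic {N : ℕ} (hN0 : N ≠ 0) {ζ : ℚ_[p]} (hζ : IsPrimitiveRoot ζ N) :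
    ¬ p ^ 2 ∣ N := by
  rintro ⟨k, hk⟩
  have hk' : IsPrimitiveRoot (ζ ^ k) (p ^ 2) := hζ.pow (Nat.pos_of_ne_zero hN0) (by rw [hk, mul_comm])
  exact not_mem_range_algebraMap_of_isPrimitiveRoot_sq p
    (hk'.map_of_injective (algebraMap ℚ_[p] (PadicAlgCl p)).injective) ⟨ζ ^ k, rfl⟩

/-- **For odd `p`, no primitive root of unity of order divisible by `p` in `ℚ_p`** (else `ζ_p ∈ ℚ_p`;
abc-iut-w5-d125's `not_mem_range_algebraMap_of_isPrimitiveRoot_prime`). [cite: SerreLocalFields1979, IV §4 Prop 17] -/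
theorem not_dvd_of_isPrimitiveRoot_padic (hp2 : p ≠ 2) {N : ℕ} (hN0 : N ≠ 0) {ζ : ℚ_[p]}
    (hζ : IsPrimitiveRoot ζ N) : ¬ p ∣ N := by
  rintro ⟨k, hk⟩
  have hk' : IsPrimitiveRoot (ζ ^ k) p := hζ.pow (Nat.pos_of_ne_zero hN0) (by rw [hk, mul_comm])
  exact not_mem_range_algebraMap_of_isPrimitiveRoot_prime p hp2
    (hk'.map_of_injective (algebraMap ℚ_[p] (PadicAlgCl p)).injective) ⟨ζ ^ k, rfl⟩

/-! ### The classification -/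

/-- **The roots of unity of `ℚ_p`**: if `ℚ_p` contains a primitive `N`-th root of unity (`N ≠ 0`) then
`N ∣ p − 1`, or `p = 2` and `N = 2` (write `N = p^a·M` with `p ∤ M`: `M ∣ p − 1`, `a ≤ 1`, and `a = 1` forces
`p = 2`, `M = 1`). [cite: Serre1973, Ch. II §3.1 Prop. 7] -/
theorem dvd_pred_or_of_isPrimitiveRoot_padic {N : ℕ} (hN0 : N ≠ 0) {ζ : ℚ_[p]} (hζ : IsPrimitiveRoot ζ N) :
    N ∣ p - 1 ∨ (p = 2 ∧ N = 2) := by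
  obtain ⟨a, M, hpM, hNM⟩ := Nat.exists_eq_pow_mul_and_not_dvd hN0 p hp.out.one_lt.ne'
  have hM0 : M ≠ 0 := fun h => hN0 (by rw [hNM, h, mul_zero])
  have hMζ : IsPrimitiveRoot (ζ ^ p ^ a) M := hζ.pow (Nat.pos_of_ne_zero hN0) hNM
  have hM : M ∣ p - 1 := dvd_pred_of_isPrimitiveRoot_padic_of_not_dvd p hM0 hpM hMζ
  rcases a with _ | _ | a
  · left
    rw [hNM, pow_zero, one_mul]
    exact hM
  · right
    have hpN : p ∣ N := ⟨M, by rw [hNM, zero_add, pow_one]⟩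
    have hp2 : p = 2 := by
      by_contra h
      exact not_dvd_of_isPrimitiveRoot_padic p h hN0 hζ hpN
    refine ⟨hp2, ?_⟩
    subst hp2
    have hM1 : M = 1 := Nat.dvd_one.mp hM
    rw [hNM, hM1]
    norm_num
  · exact absurd ⟨p ^ a * M, by rw [hNM]; ring⟩ (not_sq_dvd_of_isPrimitiveRoot_padic p hN0 hζ)

/-- Converse: `ℚ_p` contains a primitive `N`-th root of unity for `N ∣ p − 1` (Hensel; abc-iut-w5-d125's
`exists_isPrimitiveRoot_padic_of_dvd_pred`) and `−1` is a primitive square root of unity.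
[cite: Serre1973, Ch. II §3.1 Prop. 7] -/
theorem exists_isPrimitiveRoot_padic_of_dvd_pred_or {N : ℕ} (h : N ∣ p - 1 ∨ (p = 2 ∧ N = 2)) :
    ∃ ζ : ℚ_[p], IsPrimitiveRoot ζ N := by
  rcases h with h | ⟨-, rfl⟩
  · have hN0 : N ≠ 0 := by
      rintro rfl
      have h0 := Nat.eq_zero_of_zero_dvd h
      have h2 := hp.out.two_le
      omega
    exact SettingModel.exists_isPrimitiveRoot_padic_of_dvd_pred p ⟨N, Nat.pos_of_ne_zero hN0⟩ h
  · exact ⟨-1, IsPrimitiveRoot.neg_one 0 (by norm_num)⟩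

/-- **`ℚ_p` contains a primitive `N`-th root of unity iff `N ∣ p − 1 ∨ (p = 2 ∧ N = 2)`** (`N ≠ 0`).
[cite: Serre1973, Ch. II §3.1 Prop. 7] -/
theorem exists_isPrimitiveRoot_padic_iff {N : ℕ} (hN0 : N ≠ 0) :
    (∃ ζ : ℚ_[p], IsPrimitiveRoot ζ N) ↔ N ∣ p - 1 ∨ (p = 2 ∧ N = 2) :=
  ⟨fun ⟨_, hζ⟩ => dvd_pred_or_of_isPrimitiveRoot_padic p hN0 hζ, exists_isPrimitiveRoot_padic_of_dvd_pred_or p⟩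

/-- **Odd `p`: `ℚ_p` contains a primitive `N`-th root of unity iff `N ∣ p − 1`** ("the roots of unity of `ℚ_p`
form a cyclic group of order `p − 1`"). [cite: Serre1973, Ch. II §3.1 Prop. 7] -/
theorem exists_isPrimitiveRoot_padic_iff_dvd_pred (hp2 : p ≠ 2) {N : ℕ} (hN0 : N ≠ 0) :
    (∃ ζ : ℚ_[p], IsPrimitiveRoot ζ N) ↔ N ∣ p - 1 := by
  rw [exists_isPrimitiveRoot_padic_iff p hN0]
  exact ⟨fun h => h.resolve_right fun h2 => hp2 h2.1, Or.inl⟩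

/-- **`p = 2`: `ℚ₂` contains a primitive `N`-th root of unity iff `N ∣ 2`** ("the roots of unity of `ℚ₂` are
`{±1}`"). [cite: Serre1973, Ch. II §3.1 Prop. 7] -/
theorem exists_isPrimitiveRoot_padic_iff_dvd_two (hp2 : p = 2) {N : ℕ} (hN0 : N ≠ 0) :
    (∃ ζ : ℚ_[p], IsPrimitiveRoot ζ N) ↔ N ∣ 2 := by
  rw [exists_isPrimitiveRoot_padic_iff p hN0]
  subst hp2
  constructor
  · rintro (h | ⟨-, rfl⟩)
    · exact (Nat.dvd_one.mp h).symm ▸ one_dvd 2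
    · exact dvd_rfl
  · intro h
    rcases (Nat.dvd_prime Nat.prime_two).mp h with rfl | rfl
    · exact Or.inl dvd_rfl
    · exact Or.inr ⟨rfl, rfl⟩

/-! ### Galois forms in `ℚ̄_p` -/

/-- A primitive `N`-th root of unity of `ℚ̄_p` with `¬(N ∣ p − 1 ∨ (p = 2 ∧ N = 2))` does NOT lie in `ℚ_p`.
[cite: Serre1973, Ch. II §3.1 Prop. 7] -/
theorem not_mem_range_algebraMap_of_isPrimitiveRoot {N : ℕ} (hN0 : N ≠ 0) (hN : ¬ (N ∣ p - 1 ∨ (p = 2 ∧ N = 2)))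
    {ζ : PadicAlgCl p} (hζ : IsPrimitiveRoot ζ N) : ζ ∉ Set.range (algebraMap ℚ_[p] (PadicAlgCl p)) := by
  rintro ⟨x, rfl⟩
  exact hN (dvd_pred_or_of_isPrimitiveRoot_padic p hN0
    (hζ.of_map_of_injective (f := algebraMap ℚ_[p] (PadicAlgCl p)) (algebraMap ℚ_[p] (PadicAlgCl p)).injective))

/-- **Some `σ ∈ G_{ℚ_p}` moves a primitive `N`-th root of unity of `ℚ̄_p` whenever `¬(N ∣ p − 1 ∨ (p = 2 ∧ N = 2))`**
(`ℚ_p` is the fixed field of `G_{ℚ_p}`: infinite Galois correspondence). [cite: Serre1973, Ch. II §3.1 Prop. 7] -/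
theorem exists_algEquiv_apply_ne_of_isPrimitiveRoot {N : ℕ} (hN0 : N ≠ 0)
    (hN : ¬ (N ∣ p - 1 ∨ (p = 2 ∧ N = 2))) {ζ : PadicAlgCl p} (hζ : IsPrimitiveRoot ζ N) :
    ∃ σ : GQp p, σ ζ ≠ ζ := by
  by_contra hall
  haveI : IsGalois ℚ_[p] (PadicAlgCl p) := {}
  have hmem : ζ ∈ IntermediateField.fixedField (⊤ : Subgroup (GQp p)) := by
    rw [IntermediateField.mem_fixedField_iff]
    intro σ _
    by_contra hne
    exact hall ⟨σ, hne⟩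
  rw [← IntermediateField.fixingSubgroup_bot, InfiniteGalois.fixedField_fixingSubgroup,
    IntermediateField.mem_bot] at hmem
  exact not_mem_range_algebraMap_of_isPrimitiveRoot p hN0 hN hζ hmem

/-- **For `¬(N ∣ p − 1 ∨ (p = 2 ∧ N = 2))` some `σ ∈ G_{ℚ_p}` acts non-trivially on `μ_N(ℚ̄_p)`.**
[cite: MochizukiEtTh2009, Def 2.10 p.44] -/
theorem exists_galMuN_apply_ne_of_not (N : ℕ+) (hN : ¬ ((N : ℕ) ∣ p - 1 ∨ (p = 2 ∧ (N : ℕ) = 2))) :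
    ∃ (σ : GQp p) (ζ : MuN p N), galMuN p N σ ζ ≠ ζ := by
  haveI : NeZero ((N : ℕ) : PadicAlgCl p) := ⟨by exact_mod_cast N.ne_zero⟩
  obtain ⟨ζ, hζ⟩ := HasEnoughRootsOfUnity.prim (M := PadicAlgCl p) (n := (N : ℕ))
  obtain ⟨σ, hσ⟩ := exists_algEquiv_apply_ne_of_isPrimitiveRoot p N.ne_zero hN hζ
  haveI : NeZero (N : ℕ) := ⟨N.ne_zero⟩
  refine ⟨σ, hζ.toRootsOfUnity, fun h => hσ ?_⟩
  have h' := congrArg (fun u : MuN p N => ((u : (PadicAlgCl p)ˣ) : PadicAlgCl p)) h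
  simpa only [galMuN_apply_coe, IsPrimitiveRoot.val_toRootsOfUnity_coe] using h'

/-- **The mod-`N` cyclotomic character of `G_{ℚ_p}` is TRIVIAL iff `N ∣ p − 1 ∨ (p = 2 ∧ N = 2)`**: `G_{ℚ_p}` fixes
`μ_N(ℚ̄_p)` pointwise exactly when `μ_N(ℚ̄_p) ⊆ ℚ_p` (abc-iut-w5-d125's `galMuN_apply_eq_self_of_dvd_pred`,
`galMuN_two_apply` for the two trivial cases). [cite: MochizukiEtTh2009, Def 2.10 p.44] -/
theorem galMuN_eq_one_iff (N : ℕ+) : galMuN p N = 1 ↔ (N : ℕ) ∣ p - 1 ∨ (p = 2 ∧ (N : ℕ) = 2) := by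
  constructor
  · intro h
    by_contra hN
    obtain ⟨σ, ζ, hne⟩ := exists_galMuN_apply_ne_of_not p N hN
    exact hne (by rw [h]; rfl)
  · rintro (h | ⟨hp2, h2⟩)
    · ext σ ζ
      rw [SettingModel.galMuN_apply_eq_self_of_dvd_pred p N h σ ζ]
      rfl
    · subst hp2
      obtain rfl : N = 2 := PNat.coe_inj.mp h2
      ext σ ζ
      rw [SettingModel.galMuN_two_apply 2 σ ζ]
      rfl

/-- **Odd `p`: the mod-`N` cyclotomic character of `G_{ℚ_p}` is trivial iff `N ∣ p − 1`.**
[cite: MochizukiEtTh2009, Def 2.10 p.44] -/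
theorem galMuN_eq_one_iff_dvd_pred (hp2 : p ≠ 2) (N : ℕ+) : galMuN p N = 1 ↔ (N : ℕ) ∣ p - 1 := by
  rw [galMuN_eq_one_iff]
  exact ⟨fun h => h.resolve_right fun h2 => hp2 h2.1, Or.inl⟩

/-- **`p = 2`: the mod-`N` cyclotomic character of `G_{ℚ₂}` is trivial iff `N ∣ 2`.** [cite: MochizukiEtTh2009, Def 2.10 p.44] -/
theorem galMuN_eq_one_iff_dvd_two (hp2 : p = 2) (N : ℕ+) : galMuN p N = 1 ↔ (N : ℕ) ∣ 2 := by
  rw [galMuN_eq_one_iff]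
  subst hp2
  constructor
  · rintro (h | ⟨-, h⟩)
    · exact (Nat.dvd_one.mp h).symm ▸ one_dvd 2
    · exact ⟨1, by omega⟩
  · intro h
    rcases (Nat.dvd_prime Nat.prime_two).mp h with h1 | h2
    · exact Or.inl ⟨1, by omega⟩
    · exact Or.inr ⟨rfl, h2⟩

/-- Non-triviality complement of `galMuN_eq_one_iff`: `galMuN p N ≠ 1` iff `¬(N ∣ p − 1 ∨ (p = 2 ∧ N = 2))` —
subsuming abc-iut-w5-d125's `galMuN_ne_one` (`p² ∣ N`) and `galMuN_ne_one_of_prime_dvd` (odd `p ∣ N`).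
[cite: MochizukiEtTh2009, Def 2.10 p.44] -/
theorem galMuN_ne_one_iff (N : ℕ+) : galMuN p N ≠ 1 ↔ ¬ ((N : ℕ) ∣ p - 1 ∨ (p = 2 ∧ (N : ℕ) = 2)) :=
  (galMuN_eq_one_iff p N).not

end Literature.AnabelianGeometry.EtaleTheta

end
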